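import Mathlib
import HarnessLib.Audit
import Summits.PneNP.PneNP.Theorems.PstarForcing
import Summits.PneNP.PneNP.Theorems.PstarUnionCaseA

/-!
# Case A, Step 2c tool: VARIABLE CONTAINMENT by the derivative trick (ROUND-24, memo §14.19–§14.20; ASK T-UNION-TRI)

FRONTIER range-avoidance ladder, rung F-N3, ROUND 24 (cell `pnp-ideate`, planner memo `r24/CORE-BOUND-NOTES.md` §14.19–§14.20, typed sketch `r24/SketchCaseA2.lean` of
planner p3 g22 — statements (R2), (R2′), (R7′), (R7), (R7″); restricted-model proof complexity — nothing here bears on `P` versus `NP`).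

The derivative trick.  If `q` is a quadratic function that is **not constant on any proper non-empty affine hyperplane** (true as soon as its polar rank is
`≥ 4`, by (R2)), `g` is quadratic and constant on `Z(q) = {q = 0} ≠ ∅`, and `v` is an invariance direction of `q` (`q (x + v) = q x`), then `v` is an invariance
direction of `g`: the derivative `deriv g v` is affine, vanishes on the `v`-stable set `Z(q)`, hence is `≡ 0` — a non-zero affine function vanishing on `Z(q)`
would put `Z(q)` inside the hyperplane `{deriv g v = 0}`, on whose (non-empty) complement `q ≡ 1` is constant.

* `rank_le_two_of_const_on_hyperplane` — **(R2)**: a quadratic function constant on a non-empty affine hyperplane `{l = 1}` has polar rank `≤ 2` (the polar form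
  vanishes on the direction space `W = ker lin l`, so `x ↦ B x ·` maps `W` into the dual annihilator of `W`, of dimension `codim W ≤ 1`, with kernel inside `rad B`;
  the same argument as (R4) `PstarUnionCaseA.rank_le_four_of_const_on_flat`);
* `not_const_on_hyperplane_of_rank_four` — **(R2′)**: polar rank `≥ 4` ⟹ not constant on any non-empty affine hyperplane (the sketch's extra hypothesis
  `∃ h, l h = 0` is dropped: not needed);
* `invariant_of_const_on_zeros` — **(R7′)** the invariance transfer under the hypothesis "not constant on any proper non-empty hyperplane";
* `invariant_of_const_on_zeros_rank_four` — **(R7)** the same in polar rank `≥ 4` (`Z(q) ≠ ∅` is automatic, `PstarForcing.exists_ne_of_rank_four`);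
* `flip_invariant_of_const_on_zeros` — **(R7″)** coordinate form on a cube `ι → 𝔽₂` with `v := Pi.single i 1`.
-/

set_option linter.dupNamespace false -- `Summit.PneNP.PneNP.…`: summit = sub-problem name (D-0017 single-conjunct layout)

open Module
open Summit.PneNP.PneNP.Theorems.PstarCubeIdeals (IsAffineFn IsQuadFn deriv deriv_apply isAffineFn_deriv)
open Summit.PneNP.PneNP.Theorems.PstarQuadRank (rad mem_rad)
open Summit.PneNP.PneNP.Theorems.PstarRankRigidityTwo (linPart linPart_apply)
open Summit.PneNP.PneNP.Theorems.PstarLagrangian (finrank_le_finrank_inf_ker_add_one)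
open Summit.PneNP.PneNP.Theorems.PstarForcing (exists_ne_of_rank_four)
open Summit.PneNP.PneNP.Theorems.PstarUnionCaseA (second_difference)

namespace Summit.PneNP.PneNP.Theorems.PstarUnionContain

/-- Every element of `𝔽₂` is `0` or `1`. -/
private theorem zmod2_cases (t : ZMod 2) : t = 0 ∨ t = 1 := by
  revert t; decide

/-- In `𝔽₂`, `x + x = 0`. -/
private theorem zmod2_add_self (x : ZMod 2) : x + x = 0 := by
  revert x; decide

variable {M : Type*} [AddCommGroup M] [Module (ZMod 2) M] [Fintype M]

/-- **(R2)** A quadratic function constant on a non-empty affine hyperplane `{l = 1}` has polar rank `≤ 2`: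
`finrank M ≤ finrank (rad B) + 2`. -/
theorem rank_le_two_of_const_on_hyperplane {Q : M → ZMod 2} {B : LinearMap.BilinForm (ZMod 2) M}
    (hB : ∀ x w, Q (x + w) = Q x + Q w + Q 0 + B x w) {l : M → ZMod 2} (hl : IsAffineFn l) (hne : ∃ h, l h = 1)
    (hconst : ∀ x x', l x = 1 → l x' = 1 → Q x = Q x') :
    finrank (ZMod 2) M ≤ finrank (ZMod 2) (rad B) + 2 := by
  classical
  haveI : Module.Finite (ZMod 2) M := Module.Finite.of_finite
  obtain ⟨h, hh⟩ := hne
  -- the direction space of the hyperplane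
  set W : Submodule (ZMod 2) M := ⊤ ⊓ LinearMap.ker (linPart hl) with hW
  have hWmem : ∀ {x : M}, x ∈ W → l x = l 0 := by
    intro x hx
    rw [hW, Submodule.mem_inf, LinearMap.mem_ker, linPart_apply] at hx
    have e : ∀ a b : ZMod 2, a + b = 0 → a = b := by decide
    exact e _ _ hx.2
  -- translating the base point by `W` stays in the hyperplane
  have hflat : ∀ {x : M}, x ∈ W → l (h + x) = 1 := by
    intro x hx
    rw [hl h x, hh, hWmem hx, add_assoc, zmod2_add_self, add_zero]
  -- `B` vanishes on `W × W`
  have hiso : ∀ x ∈ W, ∀ w ∈ W, B x w = 0 := by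
    intro x hx w hw
    rw [← second_difference hB h x w]
    have hxw : x + w ∈ W := W.add_mem hx hw
    have e0 := hconst _ _ (hflat hxw) hh
    have e1 := hconst _ _ (hflat hx) hh
    have e2 := hconst _ _ (hflat hw) hh
    rw [show h + x + w = h + (x + w) from add_assoc h x w, e0, e1, e2]
    linear_combination 2 * zmod2_add_self (Q h)
  -- dimension of `W`: codimension at most one
  have hdimW : finrank (ZMod 2) M ≤ finrank (ZMod 2) W + 1 := by
    have a := finrank_le_finrank_inf_ker_add_one (⊤ : Submodule (ZMod 2) M) (linPart hl)
    rw [finrank_top] at a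
    rw [hW]; omega
  -- `x ↦ B x` maps `W` into the dual annihilator of `W`, with kernel inside `rad B`
  set ψ : W →ₗ[ZMod 2] Module.Dual (ZMod 2) M := B.domRestrict W with hψ
  have hrange : LinearMap.range ψ ≤ W.dualAnnihilator := by
    rintro φ ⟨x, rfl⟩
    rw [Submodule.mem_dualAnnihilator]
    intro w hw
    exact hiso x x.2 w hw
  have hker : finrank (ZMod 2) (LinearMap.ker ψ) ≤ finrank (ZMod 2) (rad B) := by
    have hle : (LinearMap.ker ψ).map W.subtype ≤ rad B := by
      rintro v ⟨x, hx, rfl⟩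
      rw [SetLike.mem_coe, LinearMap.mem_ker] at hx
      rw [mem_rad]
      intro y
      have := congrArg (fun φ : Module.Dual (ZMod 2) M => φ y) hx
      simpa [hψ] using this
    rw [← Submodule.finrank_map_subtype_eq W (LinearMap.ker ψ)]
    exact Submodule.finrank_mono hle
  have hrn := LinearMap.finrank_range_add_finrank_ker ψ
  have hann := Subspace.finrank_add_finrank_dualAnnihilator_eq W
  have hr := Submodule.finrank_mono hrange
  omega

/-- **(R2′)** Polar rank `≥ 4` ⟹ `Q` is not constant on any non-empty affine hyperplane `{l = 1}`. -/
theorem not_const_on_hyperplane_of_rank_four {Q : M → ZMod 2} {B : LinearMap.BilinForm (ZMod 2) M}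
    (hB : ∀ x w, Q (x + w) = Q x + Q w + Q 0 + B x w) (hrank : finrank (ZMod 2) (rad B) + 4 ≤ finrank (ZMod 2) M)
    {l : M → ZMod 2} (hl : IsAffineFn l) (h1 : ∃ h, l h = 1) :
    ∃ x x', l x = 1 ∧ l x' = 1 ∧ Q x ≠ Q x' := by
  by_contra hno
  push Not at hno
  have := rank_le_two_of_const_on_hyperplane hB hl h1 fun x x' hx hx' => hno x x' hx hx'
  omega

omit [Fintype M] in
/-- **(R7′) Invariance transfer.**  `q` not constant on any proper non-empty affine hyperplane, `g` quadratic and constant on `Z(q) ≠ ∅`,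
`v` an invariance direction of `q` ⟹ `v` is an invariance direction of `g`. -/
theorem invariant_of_const_on_zeros {q g : M → ZMod 2} (hg : IsQuadFn g)
    (hnc : ∀ l : M → ZMod 2, IsAffineFn l → (∃ h, l h = 1) → (∃ h, l h = 0) → ∃ x x', l x = 1 ∧ l x' = 1 ∧ q x ≠ q x')
    (hZ : ∃ x, q x = 0) {c : ZMod 2} (hconst : ∀ x, q x = 0 → g x = c) {v : M} (hv : ∀ x, q (x + v) = q x) :
    ∀ x, g (x + v) = g x := by
  -- the derivative `∂_v g` is affine and vanishes on the `v`-stable set `Z(q)`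
  have hd : IsAffineFn (deriv g v) := isAffineFn_deriv hg v
  have hdZ : ∀ x, q x = 0 → deriv g v x = 0 := by
    intro x hx
    have hxv : q (x + v) = 0 := by rw [hv x, hx]
    rw [deriv_apply, hconst x hx, hconst (x + v) hxv, zmod2_add_self]
  by_contra hno
  push Not at hno
  obtain ⟨x₁, hx₁⟩ := hno
  -- `∂_v g (x₁) = 1`
  have h1 : deriv g v x₁ = 1 := by
    rw [deriv_apply]
    rcases zmod2_cases (g (x₁ + v)) with ha | ha <;> rcases zmod2_cases (g x₁) with hb | hb <;> rw [ha, hb] at hx₁ ⊢ <;>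
      first | exact absurd rfl hx₁ | decide
  obtain ⟨x₀, hx₀⟩ := hZ
  -- so `q` would be constant `= 1` on the non-empty proper hyperplane `{∂_v g = 1}`
  obtain ⟨x, x', hx, hx', hne⟩ := hnc (deriv g v) hd ⟨x₁, h1⟩ ⟨x₀, hdZ x₀ hx₀⟩
  have hq1 : ∀ z, deriv g v z = 1 → q z = 1 := by
    intro z hz
    rcases zmod2_cases (q z) with h0 | h0
    · rw [hdZ z h0] at hz; exact absurd hz zero_ne_one
    · exact h0
  exact hne ((hq1 x hx).trans (hq1 x' hx').symm)

/-- **(R7) Invariance transfer in rank `≥ 4`.**  `q` of polar rank `≥ 4`, `g` quadratic and constant on `Z(q)`, `v` an invariance direction of `q`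
⟹ `v` is an invariance direction of `g`.  ((R7′) + (R2′); `Z(q) ≠ ∅` is automatic from `exists_ne_of_rank_four`.) -/
theorem invariant_of_const_on_zeros_rank_four {q g : M → ZMod 2} {B : LinearMap.BilinForm (ZMod 2) M}
    (hB : ∀ x w, q (x + w) = q x + q w + q 0 + B x w) (hrank : finrank (ZMod 2) (rad B) + 4 ≤ finrank (ZMod 2) M)
    (hg : IsQuadFn g) {c : ZMod 2} (hconst : ∀ x, q x = 0 → g x = c) {v : M} (hv : ∀ x, q (x + v) = q x) :
    ∀ x, g (x + v) = g x := by
  have hZ : ∃ x, q x = 0 := by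
    obtain ⟨u, hu⟩ := exists_ne_of_rank_four hB hrank
    rcases zmod2_cases (q 0) with h0 | h0
    · exact ⟨0, h0⟩
    · rcases zmod2_cases (q u) with hu0 | hu0
      · exact ⟨u, hu0⟩
      · exact absurd (hu0.trans h0.symm) hu
  exact invariant_of_const_on_zeros hg (fun l hl hl1 _ => not_const_on_hyperplane_of_rank_four hB hrank hl hl1) hZ hconst hv

/-- **(R7″) Coordinate form** on a cube `ι → 𝔽₂`: if flipping coordinate `i` never changes `q` (`i ∉ vars q`) then, under the hypotheses of (R7),
flipping `i` never changes `g` — every monomial / literal of `g` avoids `i`. -/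
theorem flip_invariant_of_const_on_zeros {ι : Type*} [Fintype ι] [DecidableEq ι]
    {q g : (ι → ZMod 2) → ZMod 2} {B : LinearMap.BilinForm (ZMod 2) (ι → ZMod 2)}
    (hB : ∀ x w, q (x + w) = q x + q w + q 0 + B x w)
    (hrank : finrank (ZMod 2) (rad B) + 4 ≤ finrank (ZMod 2) (ι → ZMod 2))
    (hg : IsQuadFn g) {c : ZMod 2} (hconst : ∀ x, q x = 0 → g x = c)
    {i : ι} (hi : ∀ x, q (x + Pi.single i 1) = q x) :
    ∀ x, g (x + Pi.single i 1) = g x :=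
  invariant_of_const_on_zeros_rank_four hB hrank hg hconst hi

end Summit.PneNP.PneNP.Theorems.PstarUnionContain
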